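import Summits.SmoothPoincare4.SmoothPoincare4.Theorems.SblfDescentRungOneHelperF3TubeModel
import Literature.Topology.FourManifolds.MorseChartChange
import Literature.Topology.FourManifolds.ImmersionCriterion
import HarnessLib

/-!
# The Bott condition of brick F3 along the round circle (layer `f3_bott`)

Auxiliary file (layer 6) of stub `helper_sliceGluing_bottConstruction` (apex brick F3: the
construction of the Morse–Bott function `F` and of the angular map `α`), line `Sketch`, crux
`SblfDescent.RungOne`.

(Crux item stmt-SmoothPoincare4-18531; skeleton `Cruxes/RungOne/Lines/Sketch.lean`.)

Let `ν : S¹ × ℝ³ → X` be the `S¹`-parametric fold tube (smooth and immersive on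
`S¹ × B(0, ε)`, `ε ≤ 1`) and `F : X → ℝ` a smooth function which in the tube is the tube model
of brick F3: `F (ν (u, y)) = g(y) = (P₀ - p₀ Q(y)) / √(1 + y₂²)` (`0 < p₀`, `4 p₀ ≤ P₀`;
layer `helper_f3_tubeModel`).  Then (`helper_f3_bott`):

* the critical points of `F` in the tube are exactly the round circle `ν(S¹ × {0})`
  (chain rule: `dν` is a linear isomorphism at every point of the tube, by the immersion
  hypothesis and a dimension count, and `F ∘ ν = g ∘ pr₂`);
* **the Bott condition**: at `ν(u, 0)` the tree's Hessian `mhessian` is negative semidefinite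
  with null space the image under `dν` of the circle direction `ℝ × {0}`.  Proof: `F` read in
  the preferred chart `φ` at `ν(u, 0)` is `(g ∘ pr₂) ∘ Ψ⁻¹` near `φ(ν(u, 0))`, where
  `Ψ = φ ∘ ν ∘ χ⁻¹` is `ν` written in the charts (`χ` the product chart of `S¹ × ℝ³`), a local
  diffeomorphism by the inverse function theorem; at a critical point the Hessian of a
  composite is the pulled-back Hessian (`fderiv_fderiv_comp_apply_of_fderiv_eq_zero`), so
  `mhessian F (w, w) = D²g(0)((dΨ⁻¹ w)₂, (dΨ⁻¹ w)₂) ≤ 0`, with equality iff `dΨ⁻¹ w ∈ ℝ × {0}`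
  (Milnor 1963, §2: the Hessian in local coordinates and its independence of the chart at a
  critical point).

## References

* J. Milnor, *Morse theory*, Ann. of Math. Studies 51 (1963), §2. [Milnor1963]
* R. Bott, *Nondegenerate critical manifolds*, Ann. of Math. 60 (1954), §1. [folklore]
-/

set_option linter.dupNamespace false

noncomputable section

open scoped Manifold ContDiff Topology
open Set Function Filter Literature.Topology.FourManifolds

namespace Summit.SmoothPoincare4.SmoothPoincare4.Cruxes.RungOne.Sketch

/-- The differential of the tube map is onto at every point where it is injective
(dimension count `1 + 3 = 4`). [folklore] -/
theorem surjective_mfderiv_tube [Fact (Module.finrank ℝ (EuclideanSpace ℝ (Fin 2)) = 1 + 1)]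
    {X : Type} [TopologicalSpace X] [ChartedSpace (EuclideanSpace ℝ (Fin 4)) X]
    {ν : (Metric.sphere (0 : EuclideanSpace ℝ (Fin 2)) 1) × EuclideanSpace ℝ (Fin 3) → X}
    {p : (Metric.sphere (0 : EuclideanSpace ℝ (Fin 2)) 1) × EuclideanSpace ℝ (Fin 3)}
    (h : Injective (mfderiv ((𝓡 1).prod 𝓘(ℝ, EuclideanSpace ℝ (Fin 3))) (𝓡 4) ν p)) :
    Surjective (mfderiv ((𝓡 1).prod 𝓘(ℝ, EuclideanSpace ℝ (Fin 3))) (𝓡 4) ν p) := by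
  have hdim : Module.finrank ℝ (EuclideanSpace ℝ (Fin 1) × EuclideanSpace ℝ (Fin 3)) =
      Module.finrank ℝ (EuclideanSpace ℝ (Fin 4)) := by simp
  exact (LinearMap.injective_iff_surjective_of_finrank_eq_finrank (f :=
    (mfderiv ((𝓡 1).prod 𝓘(ℝ, EuclideanSpace ℝ (Fin 3))) (𝓡 4) ν p).toLinearMap) hdim).1 h

/-- **Layer `f3_bott` of brick F3, part 1: the critical points of `F` in the fold tube are the
round circle.**  See the module docstring. [cite: Milnor1963, §2] -/
theorem isMCriticalPt_tube_iff [Fact (Module.finrank ℝ (EuclideanSpace ℝ (Fin 2)) = 1 + 1)]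
    {X : Type} [TopologicalSpace X] [T2Space X] [ChartedSpace (EuclideanSpace ℝ (Fin 4)) X]
    [IsManifold (𝓡 4) ∞ X] {ε : ℝ}
    {ν : (Metric.sphere (0 : EuclideanSpace ℝ (Fin 2)) 1) × EuclideanSpace ℝ (Fin 3) → X}
    {F : X → ℝ} {P₀ p₀ : ℝ} (hε1 : ε ≤ 1)
    (hνs : ContMDiffOn ((𝓡 1).prod 𝓘(ℝ, EuclideanSpace ℝ (Fin 3))) (𝓡 4) ∞ ν
      (Set.univ ×ˢ Metric.ball 0 ε))
    (hνd : ∀ p : (Metric.sphere (0 : EuclideanSpace ℝ (Fin 2)) 1) × EuclideanSpace ℝ (Fin 3),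
      p.2 ∈ Metric.ball (0 : EuclideanSpace ℝ (Fin 3)) ε →
        Injective (mfderiv ((𝓡 1).prod 𝓘(ℝ, EuclideanSpace ℝ (Fin 3))) (𝓡 4) ν p))
    (hFs : ContMDiff (𝓡 4) 𝓘(ℝ, ℝ) ∞ F) (hp : 0 < p₀) (hP : 4 * p₀ ≤ P₀)
    (hF : ∀ (u : Metric.sphere (0 : EuclideanSpace ℝ (Fin 2)) 1) (y : EuclideanSpace ℝ (Fin 3)),
      y ∈ Metric.ball (0 : EuclideanSpace ℝ (Fin 3)) ε →
        F (ν (u, y)) = (P₀ - p₀ * (y 0 ^ 2 + y 1 ^ 2 - y 2 ^ 2)) / √(1 + y 2 ^ 2))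
    (u : Metric.sphere (0 : EuclideanSpace ℝ (Fin 2)) 1) {y : EuclideanSpace ℝ (Fin 3)}
    (hy : y ∈ Metric.ball (0 : EuclideanSpace ℝ (Fin 3)) ε) :
    IsMCriticalPt (𝓡 4) F (ν (u, y)) ↔ y = 0 := by
  set I := (𝓡 1).prod 𝓘(ℝ, EuclideanSpace ℝ (Fin 3)) with hI
  set k : EuclideanSpace ℝ (Fin 3) → ℝ :=
    fun y => (P₀ - p₀ * (y 0 ^ 2 + y 1 ^ 2 - y 2 ^ 2)) / √(1 + y 2 ^ 2) with hk
  have hn : (∞ : ℕ∞ω) ≠ 0 := by simp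
  have hU : IsOpen ((Set.univ : Set (Metric.sphere (0 : EuclideanSpace ℝ (Fin 2)) 1)) ×ˢ
      Metric.ball (0 : EuclideanSpace ℝ (Fin 3)) ε) := isOpen_univ.prod Metric.isOpen_ball
  have hpU : (u, y) ∈ (Set.univ : Set (Metric.sphere (0 : EuclideanSpace ℝ (Fin 2)) 1)) ×ˢ
      Metric.ball (0 : EuclideanSpace ℝ (Fin 3)) ε := ⟨mem_univ _, hy⟩
  have hνm : MDifferentiableAt I (𝓡 4) ν (u, y) :=
    (hνs.contMDiffAt (hU.mem_nhds hpU)).mdifferentiableAt hn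
  have hFm : MDifferentiableAt (𝓡 4) 𝓘(ℝ, ℝ) F (ν (u, y)) := (hFs.contMDiffAt).mdifferentiableAt hn
  -- chain rule for `F ∘ ν`
  have hchain : mfderiv I 𝓘(ℝ, ℝ) (F ∘ ν) (u, y) =
      (mfderiv (𝓡 4) 𝓘(ℝ, ℝ) F (ν (u, y))).comp (mfderiv I (𝓡 4) ν (u, y)) :=
    mfderiv_comp (u, y) hFm hνm
  -- local formula `F ∘ ν = k ∘ pr₂`
  have hloc : (F ∘ ν) =ᶠ[𝓝 (u, y)] (k ∘ Prod.snd) := by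
    filter_upwards [hU.mem_nhds hpU] with p hp'
    rcases p with ⟨u', y'⟩
    exact hF u' y' hp'.2
  have hks : ContDiff ℝ ∞ k := contDiff_tubeModel P₀ p₀
  have hkm : MDifferentiableAt 𝓘(ℝ, EuclideanSpace ℝ (Fin 3)) 𝓘(ℝ, ℝ) k y :=
    (hks.contMDiff.contMDiffAt).mdifferentiableAt hn
  have hchain2 : mfderiv I 𝓘(ℝ, ℝ) (k ∘ Prod.snd) (u, y) =
      (fderiv ℝ k y).comp (ContinuousLinearMap.snd ℝ (EuclideanSpace ℝ (Fin 1))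
        (EuclideanSpace ℝ (Fin 3))) := by
    rw [mfderiv_comp (u, y) hkm mdifferentiableAt_snd, mfderiv_eq_fderiv, mfderiv_snd]
    rfl
  have key : (mfderiv (𝓡 4) 𝓘(ℝ, ℝ) F (ν (u, y))).comp (mfderiv I (𝓡 4) ν (u, y)) =
      (fderiv ℝ k y).comp (ContinuousLinearMap.snd ℝ (EuclideanSpace ℝ (Fin 1))
        (EuclideanSpace ℝ (Fin 3))) := by
    rw [← hchain, hloc.mfderiv_eq, hchain2]
  have hy1 : ‖y‖ < 1 := lt_of_lt_of_le (by simpa using hy) hε1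
  have hiff := fderiv_tubeModel_eq_zero_iff hp hP hy1
  constructor
  · intro hcrit
    rw [IsMCriticalPt] at hcrit
    rw [hcrit, ContinuousLinearMap.zero_comp] at key
    refine hiff.1 ?_
    ext v
    exact (DFunLike.congr_fun key ((0 : EuclideanSpace ℝ (Fin 1)), v)).symm
  · rintro rfl
    have h0 : fderiv ℝ k 0 = 0 := hiff.2 rfl
    rw [h0, ContinuousLinearMap.zero_comp] at key
    have hsurj := surjective_mfderiv_tube (hνd (u, 0) hy)
    rw [IsMCriticalPt]
    ext w
    obtain ⟨v, rfl⟩ := hsurj w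
    exact DFunLike.congr_fun key v

/-- The tube model composed with the second projection of `ℝ¹ × ℝ³` has, at a point over the
origin, the Hessian `D²g(0)` on the second components. [folklore] -/
theorem fderiv_fderiv_tubeModel_comp_snd (P₀ p₀ : ℝ) (hp0 : 0 < p₀) (hP : 4 * p₀ ≤ P₀)
    (a : EuclideanSpace ℝ (Fin 1) × EuclideanSpace ℝ (Fin 3)) (ha : a.2 = 0)
    (V W : EuclideanSpace ℝ (Fin 1) × EuclideanSpace ℝ (Fin 3)) :
    fderiv ℝ (fderiv ℝ ((fun y : EuclideanSpace ℝ (Fin 3) =>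
        (P₀ - p₀ * (y 0 ^ 2 + y 1 ^ 2 - y 2 ^ 2)) / √(1 + y 2 ^ 2)) ∘ Prod.snd)) a V W =
      -2 * p₀ * (V.2 0 * W.2 0 + V.2 1 * W.2 1) + (2 * p₀ - P₀) * (V.2 2 * W.2 2) := by
  have hks := contDiff_tubeModel P₀ p₀
  have h2 : (2 : ℕ∞ω) ≤ ∞ := by norm_cast
  have hcrit : fderiv ℝ (fun y : EuclideanSpace ℝ (Fin 3) =>
      (P₀ - p₀ * (y 0 ^ 2 + y 1 ^ 2 - y 2 ^ 2)) / √(1 + y 2 ^ 2)) (Prod.snd a) = 0 := by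
    rw [ha]
    exact (fderiv_tubeModel_eq_zero_iff hp0 hP (by simp)).2 rfl
  rw [fderiv_fderiv_comp_apply_of_fderiv_eq_zero (hks.of_le h2).contDiffAt
    contDiff_snd.contDiffAt hcrit V W, fderiv_snd, ha]
  simp only [ContinuousLinearMap.coe_snd']
  exact fderiv_fderiv_tubeModel_zero P₀ p₀ V.2 W.2

/-- **Layer `f3_bott` of brick F3, part 2: the Bott condition at the round circle.**  See the
module docstring (no smoothness of `F` off the tube is needed: the tree's `mhessian` is the
plain second derivative in the preferred chart). [cite: Milnor1963, §2] -/
theorem mhessian_tube_le [Fact (Module.finrank ℝ (EuclideanSpace ℝ (Fin 2)) = 1 + 1)]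
    {X : Type} [TopologicalSpace X] [T2Space X] [ChartedSpace (EuclideanSpace ℝ (Fin 4)) X]
    [IsManifold (𝓡 4) ∞ X] {ε : ℝ}
    {ν : (Metric.sphere (0 : EuclideanSpace ℝ (Fin 2)) 1) × EuclideanSpace ℝ (Fin 3) → X}
    {F : X → ℝ} {P₀ p₀ : ℝ} (hε : 0 < ε)
    (hνs : ContMDiffOn ((𝓡 1).prod 𝓘(ℝ, EuclideanSpace ℝ (Fin 3))) (𝓡 4) ∞ ν
      (Set.univ ×ˢ Metric.ball 0 ε))
    (hνd : ∀ p : (Metric.sphere (0 : EuclideanSpace ℝ (Fin 2)) 1) × EuclideanSpace ℝ (Fin 3),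
      p.2 ∈ Metric.ball (0 : EuclideanSpace ℝ (Fin 3)) ε →
        Injective (mfderiv ((𝓡 1).prod 𝓘(ℝ, EuclideanSpace ℝ (Fin 3))) (𝓡 4) ν p))
    (hp : 0 < p₀) (hP : 4 * p₀ ≤ P₀)
    (hF : ∀ (u : Metric.sphere (0 : EuclideanSpace ℝ (Fin 2)) 1) (y : EuclideanSpace ℝ (Fin 3)),
      y ∈ Metric.ball (0 : EuclideanSpace ℝ (Fin 3)) ε →
        F (ν (u, y)) = (P₀ - p₀ * (y 0 ^ 2 + y 1 ^ 2 - y 2 ^ 2)) / √(1 + y 2 ^ 2))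
    (u : Metric.sphere (0 : EuclideanSpace ℝ (Fin 2)) 1) (w : EuclideanSpace ℝ (Fin 4)) :
    mhessian (𝓡 4) F (ν (u, 0)) w w ≤ 0 ∧ (mhessian (𝓡 4) F (ν (u, 0)) w w = 0 →
      ∃ t : EuclideanSpace ℝ (Fin 1),
        mfderiv ((𝓡 1).prod 𝓘(ℝ, EuclideanSpace ℝ (Fin 3))) (𝓡 4) ν (u, 0) (t, 0) = w) := by
  set I := (𝓡 1).prod 𝓘(ℝ, EuclideanSpace ℝ (Fin 3)) with hI
  set k : EuclideanSpace ℝ (Fin 3) → ℝ :=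
    fun y => (P₀ - p₀ * (y 0 ^ 2 + y 1 ^ 2 - y 2 ^ 2)) / √(1 + y 2 ^ 2) with hk
  have hn : (∞ : ℕ∞ω) ≠ 0 := by simp
  set p₀' : (Metric.sphere (0 : EuclideanSpace ℝ (Fin 2)) 1) × EuclideanSpace ℝ (Fin 3) :=
    (u, 0) with hp₀'
  set x₀ : X := ν p₀' with hx₀
  have hU : IsOpen ((Set.univ : Set (Metric.sphere (0 : EuclideanSpace ℝ (Fin 2)) 1)) ×ˢ
      Metric.ball (0 : EuclideanSpace ℝ (Fin 3)) ε) := isOpen_univ.prod Metric.isOpen_ball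
  have hpU : p₀' ∈ (Set.univ : Set (Metric.sphere (0 : EuclideanSpace ℝ (Fin 2)) 1)) ×ˢ
      Metric.ball (0 : EuclideanSpace ℝ (Fin 3)) ε := ⟨mem_univ _, by simp [hp₀', hε]⟩
  have hνc : ContMDiffAt I (𝓡 4) ∞ ν p₀' := hνs.contMDiffAt (hU.mem_nhds hpU)
  have hνm : MDifferentiableAt I (𝓡 4) ν p₀' := hνc.mdifferentiableAt hn
  -- the charts
  set φ := extChartAt (𝓡 4) x₀ with hφ
  set χ := extChartAt I p₀' with hχ
  set a : EuclideanSpace ℝ (Fin 1) × EuclideanSpace ℝ (Fin 3) := χ p₀' with ha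
  set Ψ : EuclideanSpace ℝ (Fin 1) × EuclideanSpace ℝ (Fin 3) → EuclideanSpace ℝ (Fin 4) :=
    writtenInExtChartAt I (𝓡 4) p₀' ν with hΨ
  have hrange : Set.range I = univ := ModelWithCorners.Boundaryless.range_eq_univ
  have hχsymm2 : ∀ r : EuclideanSpace ℝ (Fin 1) × EuclideanSpace ℝ (Fin 3), (χ.symm r).2 = r.2 := by
    intro r
    rw [hχ, hI, extChartAt_prod]
    rfl
  have ha2 : a.2 = 0 := by
    rw [ha, hχ, hI, extChartAt_prod]
    rfl
  -- `Ψ` is smooth at `a` with derivative `dν`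
  have hΨd : HasFDerivAt Ψ (mfderiv I (𝓡 4) ν p₀') a := by
    have h := hνm.hasMFDerivAt.2
    rw [hrange] at h
    exact h.hasFDerivAt_of_univ
  have hΨs : ContDiffAt ℝ ∞ Ψ a := by
    have h := (contMDiffAt_iff.1 hνc).2
    rw [hrange] at h
    exact h.contDiffAt univ_mem
  -- `dν` is a linear isomorphism
  set D : (EuclideanSpace ℝ (Fin 1) × EuclideanSpace ℝ (Fin 3)) →L[ℝ] EuclideanSpace ℝ (Fin 4) :=
    mfderiv I (𝓡 4) ν p₀' with hD
  have hbij : Bijective D :=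
    ⟨hνd p₀' hpU.2, surjective_mfderiv_tube (hνd p₀' hpU.2)⟩
  set L : (EuclideanSpace ℝ (Fin 1) × EuclideanSpace ℝ (Fin 3)) ≃L[ℝ] EuclideanSpace ℝ (Fin 4) :=
    (LinearEquiv.ofBijective D.toLinearMap hbij).toContinuousLinearEquiv with hL
  have hLcoe : (L : (EuclideanSpace ℝ (Fin 1) × EuclideanSpace ℝ (Fin 3)) →L[ℝ]
      EuclideanSpace ℝ (Fin 4)) = D := ContinuousLinearMap.ext fun v => rfl
  have hΨd' : HasFDerivAt Ψ (L : (EuclideanSpace ℝ (Fin 1) × EuclideanSpace ℝ (Fin 3)) →L[ℝ]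
      EuclideanSpace ℝ (Fin 4)) a := by
    rw [hLcoe]; exact hΨd
  -- inverse function theorem
  set H := hΨs.toOpenPartialHomeomorph Ψ hΨd' hn with hH
  have hHa : a ∈ H.source := hΨs.mem_toOpenPartialHomeomorph_source hΨd' hn
  have hHt : Ψ a ∈ H.target := hΨs.image_mem_toOpenPartialHomeomorph_target hΨd' hn
  have hHcoe : (H : (EuclideanSpace ℝ (Fin 1) × EuclideanSpace ℝ (Fin 3)) →
      EuclideanSpace ℝ (Fin 4)) = Ψ := rfl
  have hτs : ContDiffAt ℝ ∞ H.symm (Ψ a) := hΨs.to_localInverse hΨd' hn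
  have hτd : HasFDerivAt H.symm (L.symm : EuclideanSpace ℝ (Fin 4) →L[ℝ]
      (EuclideanSpace ℝ (Fin 1) × EuclideanSpace ℝ (Fin 3))) (Ψ a) :=
    ((hΨs.hasStrictFDerivAt' hΨd' hn).to_localInverse).hasFDerivAt
  have hτa : H.symm (Ψ a) = a := hΨs.localInverse_apply_image hΨd' hn
  -- `Ψ a = φ x₀`
  have hΨa : Ψ a = φ x₀ := by
    simp only [hΨ, writtenInExtChartAt, comp_apply, ha, hχ, extChartAt_to_inv]
    rfl
  -- the local identity `F ∘ φ⁻¹ = (k ∘ pr₂) ∘ H⁻¹` near `φ x₀`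
  have hcont : ContinuousAt (fun r : EuclideanSpace ℝ (Fin 1) × EuclideanSpace ℝ (Fin 3) =>
      ν (χ.symm r)) a := by
    refine ContinuousAt.comp ?_ ?_
    · rw [ha, hχ, extChartAt_to_inv]; exact hνc.continuousAt
    · exact continuousAt_extChartAt_symm p₀'
  have hτc : ContinuousAt H.symm (Ψ a) := H.continuousAt_symm hHt
  have hev1 : ∀ᶠ z in 𝓝 (Ψ a), z ∈ H.target := H.open_target.mem_nhds hHt
  have hev2 : ∀ᶠ z in 𝓝 (Ψ a), ν (χ.symm (H.symm z)) ∈ φ.source := by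
    have h1 : ∀ᶠ r in 𝓝 a, ν (χ.symm r) ∈ φ.source := by
      refine hcont.preimage_mem_nhds ?_
      rw [ha, hχ, extChartAt_to_inv]
      exact (isOpen_extChartAt_source x₀).mem_nhds (mem_extChartAt_source x₀)
    have h2 : Tendsto H.symm (𝓝 (Ψ a)) (𝓝 a) := by
      have := hτc.tendsto
      rwa [hτa] at this
    exact h2.eventually h1
  have hev3 : ∀ᶠ z in 𝓝 (Ψ a), (H.symm z).2 ∈ Metric.ball (0 : EuclideanSpace ℝ (Fin 3)) ε := by
    have h1 : ∀ᶠ r in 𝓝 a, r.2 ∈ Metric.ball (0 : EuclideanSpace ℝ (Fin 3)) ε := by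
      refine continuous_snd.continuousAt.preimage_mem_nhds ?_
      rw [ha2]
      exact Metric.isOpen_ball.mem_nhds (by simp [hε])
    have h2 : Tendsto H.symm (𝓝 (Ψ a)) (𝓝 a) := by
      have := hτc.tendsto
      rwa [hτa] at this
    exact h2.eventually h1
  have hloc : (F ∘ φ.symm) =ᶠ[𝓝 (Ψ a)] ((k ∘ Prod.snd) ∘ H.symm) := by
    filter_upwards [hev1, hev2, hev3] with z hz1 hz2 hz3
    have hzz : Ψ (H.symm z) = z := by rw [← hHcoe]; exact H.right_inv hz1
    -- `z = φ (ν (χ.symm (H.symm z)))`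
    have hz : φ.symm z = ν (χ.symm (H.symm z)) := by
      conv_lhs => rw [← hzz]
      simp only [hΨ, writtenInExtChartAt, comp_apply]
      exact φ.left_inv hz2
    simp only [comp_apply, hz]
    have := hF (χ.symm (H.symm z)).1 (χ.symm (H.symm z)).2 (by rw [hχsymm2]; exact hz3)
    rw [Prod.mk.eta] at this
    rw [this, hχsymm2]
  -- the Hessian in the preferred chart
  have hmh : mhessian (𝓡 4) F x₀ w w = fderiv ℝ (fderiv ℝ (F ∘ φ.symm)) (φ x₀) w w := by
    rw [mhessian]
    simp only [LinearMap.coe_comp, comp_apply, ContinuousLinearMap.coe_coe,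
      ContinuousLinearMap.coeLM_apply, ModelWithCorners.Boundaryless.range_eq_univ,
      fderivWithin_univ, writtenInExtChartAt_eq_comp_extend_symm]
    rfl
  -- transport through `H⁻¹`
  have hkps : ContDiff ℝ ∞ (k ∘ (Prod.snd : EuclideanSpace ℝ (Fin 1) × EuclideanSpace ℝ (Fin 3) →
      EuclideanSpace ℝ (Fin 3))) := (contDiff_tubeModel P₀ p₀).comp contDiff_snd
  have hcritk : fderiv ℝ (k ∘ Prod.snd) (H.symm (Ψ a)) = 0 := by
    rw [hτa]
    -- first derivative: chain rule with `pr₂`, then `dk(0) = 0`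
    have hd : fderiv ℝ (k ∘ Prod.snd) a = (fderiv ℝ k a.2).comp (fderiv ℝ Prod.snd a) :=
      fderiv_comp a (((contDiff_tubeModel P₀ p₀).differentiable (by simp)) a.2)
        differentiableAt_snd
    rw [hd, ha2, (fderiv_tubeModel_eq_zero_iff hp hP (by simp)).2 rfl, ContinuousLinearMap.zero_comp]
  have heq : fderiv ℝ (fderiv ℝ (F ∘ φ.symm)) (φ x₀) w w =
      fderiv ℝ (fderiv ℝ (k ∘ Prod.snd)) a (L.symm w) (L.symm w) := by
    have h2 : (2 : ℕ∞ω) ≤ ∞ := by norm_cast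
    rw [← hΨa, (hloc.fderiv).fderiv_eq]
    rw [fderiv_fderiv_comp_apply_of_fderiv_eq_zero ((hkps.of_le h2).contDiffAt)
      (hτs.of_le h2) hcritk w w, hτd.fderiv, hτa]
    rfl
  rw [hmh, heq, fderiv_fderiv_tubeModel_comp_snd P₀ p₀ hp hP a ha2]
  -- negativity and the kernel
  set V := L.symm w with hV
  have hP2 : 2 * p₀ < P₀ := by linarith
  constructor
  · by_cases hV2 : V.2 = 0
    · rw [hV2]; simp
    · have := fderiv_fderiv_tubeModel_zero_self_neg hp hP2 hV2
      rw [fderiv_fderiv_tubeModel_zero] at this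
      exact this.le
  · intro h0
    have hV2 : V.2 = 0 := by
      by_contra hV2
      have := fderiv_fderiv_tubeModel_zero_self_neg hp hP2 hV2
      rw [fderiv_fderiv_tubeModel_zero] at this
      linarith
    refine ⟨V.1, ?_⟩
    have hVeq : ((V.1, (0 : EuclideanSpace ℝ (Fin 3))) :
        EuclideanSpace ℝ (Fin 1) × EuclideanSpace ℝ (Fin 3)) = V := Prod.ext rfl hV2.symm
    have hw : L V = w := by rw [hV]; simp
    rw [hVeq, ← hw]
    rfl

/-- **Layer `f3_bott` of brick F3: critical points in the fold tube and the Bott condition at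
the round circle.**  For the `S¹`-parametric fold tube `ν` (smooth and immersive on
`S¹ × B(0, ε)`, `ε ≤ 1`) and a smooth `F : X → ℝ` equal in the tube to the tube model
`(P₀ - p₀ Q(y)) / √(1 + y₂²)` (`0 < p₀`, `4 p₀ ≤ P₀`): the critical points of `F` in the tube
are exactly the points `ν(u, 0)` of the round circle, and there the Hessian `mhessian` is
negative semidefinite with null space the `dν`-image of the circle direction (Milnor 1963, §2;
Bott's nondegeneracy in the normal directions).  The `Fact` binder is the dimension instance
of the circle's charts. [cite: Milnor1963, §2] -/
theorem helper_f3_bott : ∀ [Fact (Module.finrank ℝ (EuclideanSpace ℝ (Fin 2)) = 1 + 1)] (X : Type) [TopologicalSpace X] [T2Space X] [ChartedSpace (EuclideanSpace ℝ (Fin 4)) X] [IsManifold (𝓡 4) ∞ X] (ε : ℝ) (ν : (Metric.sphere (0 : EuclideanSpace ℝ (Fin 2)) 1) × EuclideanSpace ℝ (Fin 3) → X) (F : X → ℝ) (P₀ p₀ : ℝ), 0 < ε → ε ≤ 1 → ContMDiffOn ((𝓡 1).prod 𝓘(ℝ, EuclideanSpace ℝ (Fin 3))) (𝓡 4) ∞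 ν (Set.univ ×ˢ Metric.ball 0 ε) → (∀ p : (Metric.sphere (0 : EuclideanSpace ℝ (Fin 2)) 1) × EuclideanSpace ℝ (Fin 3), p.2 ∈ Metric.ball (0 : EuclideanSpace ℝ (Fin 3)) ε → Function.Injective (mfderiv ((𝓡 1).prod 𝓘(ℝ, EuclideanSpace ℝ (Fin 3))) (𝓡 4) ν p)) → ContMDiff (𝓡 4) 𝓘(ℝ, ℝ) ∞ F → 0 < p₀ → 4 * p₀ ≤ P₀ → (∀ (u : Metric.sphere (0 : EuclideanSpace ℝ (Fin 2)) 1) (y : EuclideanSpace ℝ (Fin 3)), y ∈ Metric.ball (0 : EuclideanSpace ℝ (Fin 3)) ε → F (ν (u, y)) = (P₀ - p₀ * (y 0 ^ 2 + y 1 ^ 2 - y 2 ^ 2)) / √(1 + y 2 ^ 2)) → (∀ (u : Metric.sphere (0 : EuclideanSpace ℝ (Fin 2)) 1) (y : EuclideanSpace ℝ (Fin 3)), y ∈ Metric.ball (0 : EuclideanSpace ℝ (Fin 3)) ε → (IsMCriticalPt (𝓡 4) F (ν (u, y)) ↔ y = 0)) ∧ (∀ (u : Metric.sphere (0 : EuclideanSpace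 ℝ (Fin 2)) 1) (w : EuclideanSpace ℝ (Fin 4)), mhessian (𝓡 4) F (ν (u, 0)) w w ≤ 0 ∧ (mhessian (𝓡 4) F (ν (u, 0)) w w = 0 → ∃ t : EuclideanSpace ℝ (Fin 1), mfderiv ((𝓡 1).prod 𝓘(ℝ, EuclideanSpace ℝ (Fin 3))) (𝓡 4) ν (u, 0) (t, 0) = w)) := by
  intro _ X _ _ _ _ ε ν F P₀ p₀ hε hε1 hνs hνd hFs hp hP hF
  exact ⟨fun u y hy => isMCriticalPt_tube_iff hε1 hνs hνd hFs hp hP hF u hy,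
    fun u w => mhessian_tube_le hε hνs hνd hp hP hF u w⟩

end Summit.SmoothPoincare4.SmoothPoincare4.Cruxes.RungOne.Sketch

end
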